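import Summits.BirchSwinnertonDyer.BirchSwinnertonDyer.Theorems.KimAtThreeDeepLowerOffStratumLevelLoweringVatsalStabRows
import Literature.NumberTheory.EllipticCurves.ModularSymbolsManin
import Literature.NumberTheory.EllipticCurves.HeckeOnManinSymbolsBoundary
import HarnessLib

/-!
# Route `KimAtThreeKolyvagin` (rung W2), crux `DeepLowerAtThreeOffKatoStratum` (item 19679), registered
# stub `stub_nonAdditive`, ROAD (b): the CANONICAL-PERIOD NORMALISATION `Ω` of the plus symbol of a newform of
# squarefree level — integral on `ℚ` and a UNIT ON ONE CYCLE — from one non-Eisenstein prime (residual (R3′))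

Cell `bsd-addord`, seat `bsd-addord-w2-acc2` (PROGRAMME PART 1b, ACCEL-LIST row (2)), gen 5; item
`stmt-BirchSwinnertonDyer-19679` (OWNER w2-c2 assembles; `--supports`, closes nothing). THEOREM D
(`…VatsalIhara.exists_valuation_stabilisedSymbol_eq_one_of_ribet1984_iharaLemma`) and its rows
(`…VatsalIharaRows`) display a normalisation `Ω ∈ ℂ` of `Φ = plusSymbol g` (`g` a newform of level `M`) with
`Φ(x)/Ω` `3`-integral for EVERY `x ∈ ℚ` and `Φ(γ₀∞)/Ω` a UNIT for ONE `γ₀ ∈ Γ₀(M)` (non-degeneracy on a cycle of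
`X₀(M)`) — in print the canonical period of `g` (Vatsal 1999 (1.3) display (5), Remark (1.12)). THIS FILE
CONSTRUCTS such an `Ω` for SQUAREFREE `M`, given ONE prime `r ∤ M` with `a_r(g) − (r + 1)` a `3`-adic unit
(non-Eisenstein; on the rows: `a_r(g) ≡ a_r(E)` and `ρ̄_{E,3}` irreducible). Theorems only; no definition, no
named fact, no `sorry`.

* §1 `exists_sl_apply_eq_num_den` (every `x ∈ ℚ` is `k∞`, `k ∈ SL₂(ℤ)` with first column `(num x, den x)`);
  denominators under the Hecke correspondence at a prime `r ∤ M`: `gcd(den((x+j)/r), M) = gcd(den x, M) =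
  gcd(den(rx), M)` (`int_gcd_den_*`).
* §2 `norm_re_inftySymbol_le_sup` — BOUNDED DENOMINATORS: by Manin's continued-fraction trick
  (`ModularSymbolsManin.exists_chain`: `{∞, k∞}_g = Σ_q c_q·m_q(g)`, `c_q ∈ ℤ`, over the FINITE coset space
  `SL₂(ℤ)/Γ₀(M)`), every `Re{∞, x}_g = plusSymbol g x` read in `ℚ̄₃` has norm at most
  `C = max_q ‖ι⁻¹ Re m_q(g)‖`, and the maximum is attained at a PATH `{∞, x⋆}` (ultrametric).
* §3 ★ `exists_period_integral_unit_cycle` — **for `g` a newform of SQUAREFREE level `M` and a prime `r ∤ M` with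
  `a_r(g) − r − 1` a unit, there is `Ω` with `plusSymbol g x/Ω` integral for all `x ∈ ℚ` and `plusSymbol g (γ₀∞)/Ω`
  a unit for some `γ₀ ∈ Γ₀(M)` with `γ₀∞ ≠ ∞`.** With `Ω = plusSymbol g x⋆` integrality is §2. If every CYCLE
  value were in `𝔪Ω`, the reduction `φ̄ = (Φ/Ω mod 𝔪)` would satisfy `φ̄(γx) = φ̄(x)` (Manin relation
  `inftySymbol_mul_of_mem`: `{∞, γk∞} = {∞, γ∞} + {∞, k∞}`), hence depend only on the cusp class of `x`, which at
  SQUAREFREE level is `gcd(den x, M)` (`cuspOrbitOf_eq_of_cuspDivisor_eq`, Diamond–Shurman §3.8); the `r + 1`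
  cusps `(x+j)/r`, `rx` of `T_r{∞, x}` share that invariant (§1), so the Hecke relation
  `a_r Φ(x) = Σ_j Φ((x+j)/r) + Φ(rx)` (`cuspCoeff_mul_plusSymbol`) reads `(a_r − r − 1)·φ̄(x) = 0`, i.e. `φ̄ ≡ 0` —
  contradicting `φ̄(x⋆) = 1`. (This is the Eisenstein/boundary-symbol dichotomy behind Vatsal's `η_r = T_r − 1 − ⟨r⟩`,
  (1.5)–(1.6), and Mazur's «Manin–Drinfeld at non-Eisenstein 𝔪».)

## References

* V. Vatsal, Duke Math. J. 98 (1999), §1 (1.3) display (5), (1.5)–(1.6), Remark (1.12). [Vatsal1999]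
* J. E. Cremona, *Algorithms for modular elliptic curves* (1997), §2.1–§2.4, §2.8. [CremonaAlgorithms1997]
* Ju. I. Manin, Izv. Akad. Nauk SSSR 36 (1972), Thm. 1.6, Thm. 1.9, Cor. 3.6. [Manin1972]
* F. Diamond, J. Shurman (2005), §3.8 (cusps of `Γ₀(N)`), Prop. 5.2.2. [DiamondShurman2005]
-/

set_option autoImplicit false
-- the Theorems namespace of a single-conjunct summit repeats the summit name by design (D-0017)
set_option linter.dupNamespace false

noncomputable section

open scoped MatrixGroups ModularForm Classical NNReal

open CongruenceSubgroup WeierstrassCurve Literature.NumberTheory.EllipticCurves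
  Literature.NumberTheory.EllipticCurves.ModularForms ModularGroup
open UpperHalfPlane hiding I

namespace Summit.BirchSwinnertonDyer.BirchSwinnertonDyer.Theorems.KimAtThreeDeepLowerOffStratumLevelLoweringCanonicalPeriod

open Summit.BirchSwinnertonDyer.BirchSwinnertonDyer.Theorems.KimAtThreeDeepLowerOffStratumLevelLoweringVatsal
open Summit.BirchSwinnertonDyer.BirchSwinnertonDyer.Theorems.KimAtThreeDeepLowerOffStratumLevelLoweringVatsalStabRows

/-! ### §1 Cusps as `k∞` and denominators under the Hecke correspondence -/

section Cusps

/-- **Every rational is `k∞` for some `k ∈ SL₂(ℤ)` with first column `(num x, den x)`** (Bezout).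
[folklore] -/
theorem exists_sl_apply_eq_num_den (x : ℚ) : ∃ k : SL(2, ℤ), k 0 0 = x.num ∧ k 1 0 = x.den := by
  have hcop : Int.gcd x.num (x.den : ℤ) = 1 := by
    change x.num.natAbs.gcd (x.den : ℤ).natAbs = 1
    rw [Int.natAbs_natCast]
    exact x.reduced
  have hbez := Int.gcd_eq_gcd_ab x.num (x.den : ℤ)
  rw [hcop, Nat.cast_one] at hbez
  set u := Int.gcdA x.num (x.den : ℤ)
  set v := Int.gcdB x.num (x.den : ℤ)
  refine ⟨⟨!![x.num, -v; (x.den : ℤ), u], ?_⟩, rfl, rfl⟩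
  rw [Matrix.det_fin_two_of]
  linear_combination -hbez

/-- `{∞, k∞}_h = {∞, x}_h` for such a `k`. [folklore] -/
theorem inftySymbol_eq_modularSymbol {M : ℕ} (h : CuspForm (Gamma0 M) 2) {x : ℚ} {k : SL(2, ℤ)}
    (h0 : k 0 0 = x.num) (h1 : k 1 0 = x.den) : inftySymbol h k = modularSymbol h x := by
  have hne : k 1 0 ≠ 0 := by rw [h1]; exact_mod_cast x.den_ne_zero
  rw [inftySymbol, if_neg hne, h0, h1]
  congr 1
  push_cast
  exact Rat.num_div_den x

/-- `gcd(den, M)` is unchanged when the denominator is multiplied or divided by factors prime to `M`: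
if `d ∣ d' u` and `d' ∣ d v` with `u, v` prime to `M` then `gcd(d, M) = gcd(d', M)`. [folklore] -/
theorem gcd_eq_gcd_of_dvd_mul {M d d' u v : ℕ} (hu : Nat.Coprime u M) (hv : Nat.Coprime v M)
    (h1 : d ∣ d' * u) (h2 : d' ∣ d * v) : Nat.gcd d M = Nat.gcd d' M := by
  apply Nat.dvd_antisymm
  · have : Nat.gcd d M ∣ Nat.gcd (d' * u) M := Nat.gcd_dvd_gcd_of_dvd_left M h1
    rwa [Nat.gcd_mul_left_left_of_gcd_eq_one hu] at this
  · have : Nat.gcd d' M ∣ Nat.gcd (d * v) M := Nat.gcd_dvd_gcd_of_dvd_left M h2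
    rwa [Nat.gcd_mul_left_left_of_gcd_eq_one hv] at this

/-- Adding an integer does not change the denominator class: `gcd(den(x + j), M) = gcd(den x, M)`. [folklore] -/
theorem gcd_den_add_intCast (M : ℕ) (x : ℚ) (j : ℤ) : Nat.gcd (x + j).den M = Nat.gcd x.den M := by
  rw [Rat.add_intCast_den]

/-- Dividing by a prime `r ∤ M`: `gcd(den(x / r), M) = gcd(den x, M)`. [folklore] -/
theorem gcd_den_div_prime {M r : ℕ} (hr : r.Prime) (hrM : ¬ r ∣ M) (x : ℚ) :
    Nat.gcd (x / r).den M = Nat.gcd x.den M := by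
  have hcop : Nat.Coprime r M := (Nat.Prime.coprime_iff_not_dvd hr).mpr hrM
  have hr0 : (r : ℚ) ≠ 0 := by exact_mod_cast hr.ne_zero
  have h1 : (x / r).den ∣ x.den * r := by
    have := Rat.mul_den_dvd x (r : ℚ)⁻¹
    rwa [Rat.inv_natCast_den, if_neg hr.ne_zero, ← div_eq_mul_inv] at this
  have h2 : x.den ∣ (x / r).den * 1 := by
    have := Rat.mul_den_dvd (x / r) (r : ℚ)
    rwa [div_mul_cancel₀ x hr0, Rat.den_natCast] at this
  exact gcd_eq_gcd_of_dvd_mul hcop (Nat.coprime_one_left M) h1 h2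

/-- Multiplying by a prime `r ∤ M`: `gcd(den(r x), M) = gcd(den x, M)`. [folklore] -/
theorem gcd_den_prime_mul {M r : ℕ} (hr : r.Prime) (hrM : ¬ r ∣ M) (x : ℚ) :
    Nat.gcd ((r : ℚ) * x).den M = Nat.gcd x.den M := by
  have hr0 : (r : ℚ) ≠ 0 := by exact_mod_cast hr.ne_zero
  have := gcd_den_div_prime hr hrM ((r : ℚ) * x)
  rw [mul_div_cancel_left₀ x hr0] at this
  exact this.symm

end Cusps

/-! ### §2 Bounded denominators of the real parts of `{∞, x}_g` (Manin's trick) and the maximal path value -/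

section Bounded

variable {M : ℕ} [NeZero M] (g : CuspForm (Gamma0 M) 2) (ι : PadicAlgCl 3 ≃+* ℂ)

/-- **`Re{∞, k∞}_g` is an integral combination of the finitely many M-symbol values `Re m_q(g)`**
(`ModularSymbolsManin.exists_chain`: continued fractions). [cite: CremonaAlgorithms1997, §2.3] [cite: Manin1972, Thm. 1.6] -/
theorem exists_re_inftySymbol_eq_sum (k : SL(2, ℤ)) :
    ∃ c : Gamma0Coset M → ℤ,
      (((inftySymbol g k).re : ℝ) : ℂ) = ∑ q, (c q : ℂ) * ((((msymbol M q) g).re : ℝ) : ℂ) := by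
  obtain ⟨c, hcint, hcm, -⟩ := exists_chain (N := M) k
  choose m hm using hcint
  refine ⟨m, ?_⟩
  have heval : inftySymbol g k = ∑ q, (c q : ℂ) * (msymbol M q) g := by
    have h := LinearMap.congr_fun hcm g
    rw [inftyFunctional_apply] at h
    rw [← h, msymbolMap, Fintype.linearCombination_apply, LinearMap.sum_apply]
    refine Finset.sum_congr rfl fun q _ ↦ ?_
    rw [LinearMap.smul_apply, Rat.smul_def]
  rw [heval, Complex.re_sum, Complex.ofReal_sum]
  refine Finset.sum_congr rfl fun q _ ↦ ?_
  rw [hm q, show ((m q : ℚ) : ℂ) = ((m q : ℝ) : ℂ) by push_cast; rfl, Complex.re_ofReal_mul]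
  push_cast
  rfl

/-- **Bounded denominators**: `‖ι⁻¹ Re{∞, k∞}_g‖ ≤ C := max_q ‖ι⁻¹ Re m_q(g)‖` for every `k ∈ SL₂(ℤ)`
(ultrametric inequality on the integral combination of §2). [cite: MazurTateTeitelbaum1986Invent, §I.8] -/
theorem norm_re_inftySymbol_le_sup (k : SL(2, ℤ)) :
    ‖ι.symm (((inftySymbol g k).re : ℝ) : ℂ)‖ ≤
      Finset.univ.sup' ⟨((1 : SL(2, ℤ)) : Gamma0Coset M), Finset.mem_univ _⟩
        (fun q : Gamma0Coset M ↦ ‖ι.symm ((((msymbol M q) g).re : ℝ) : ℂ)‖) := by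
  set C := Finset.univ.sup' ⟨((1 : SL(2, ℤ)) : Gamma0Coset M), Finset.mem_univ _⟩
    (fun q : Gamma0Coset M ↦ ‖ι.symm ((((msymbol M q) g).re : ℝ) : ℂ)‖) with hC
  have hCq : ∀ q, ‖ι.symm ((((msymbol M q) g).re : ℝ) : ℂ)‖ ≤ C := fun q ↦
    Finset.le_sup' (fun q : Gamma0Coset M ↦ ‖ι.symm ((((msymbol M q) g).re : ℝ) : ℂ)‖) (Finset.mem_univ q)
  have hC0 : 0 ≤ C := (norm_nonneg _).trans (hCq ((1 : SL(2, ℤ)) : Gamma0Coset M))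
  obtain ⟨c, hc⟩ := exists_re_inftySymbol_eq_sum g k
  rw [hc, map_sum]
  refine IsUltrametricDist.norm_sum_le_of_forall_le_of_nonneg hC0 fun q _ ↦ ?_
  rw [map_mul, map_intCast, norm_mul]
  exact mul_le_of_le_one_left (norm_nonneg _) (norm_intCast_le_one _) |>.trans (hCq q)

/-- **The maximum is attained at a path**: some `Re{∞, k⋆∞}_g` has norm exactly `C` (each `m_q(g)` is a
difference `{∞, k∞} − {∞, kS∞}` of two path values, both of norm `≤ C`). [folklore] -/
theorem exists_norm_re_inftySymbol_eq_sup :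
    ∃ k : SL(2, ℤ), ‖ι.symm (((inftySymbol g k).re : ℝ) : ℂ)‖ =
      Finset.univ.sup' ⟨((1 : SL(2, ℤ)) : Gamma0Coset M), Finset.mem_univ _⟩
        (fun q : Gamma0Coset M ↦ ‖ι.symm ((((msymbol M q) g).re : ℝ) : ℂ)‖) := by
  set C := Finset.univ.sup' ⟨((1 : SL(2, ℤ)) : Gamma0Coset M), Finset.mem_univ _⟩
    (fun q : Gamma0Coset M ↦ ‖ι.symm ((((msymbol M q) g).re : ℝ) : ℂ)‖) with hC
  obtain ⟨q₀, -, hq₀⟩ := Finset.exists_mem_eq_sup' ⟨((1 : SL(2, ℤ)) : Gamma0Coset M), Finset.mem_univ _⟩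
    (fun q : Gamma0Coset M ↦ ‖ι.symm ((((msymbol M q) g).re : ℝ) : ℂ)‖)
  -- `m_{q₀}(g) = {∞, k₀⁻¹∞} − {∞, k₀⁻¹S∞}`
  set k₀ : SL(2, ℤ) := Quotient.out q₀ with hk₀
  have hq : (msymbol M q₀) g = inftySymbol g k₀⁻¹ - inftySymbol g (k₀⁻¹ * S) := by
    have : q₀ = (k₀ : Gamma0Coset M) := (Quotient.out_eq q₀).symm
    rw [this, msymbol_mk, msymbolFunctional_apply, msymbolSL]
  have hA := norm_re_inftySymbol_le_sup g ι k₀⁻¹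
  have hB := norm_re_inftySymbol_le_sup g ι (k₀⁻¹ * S)
  rw [← hC] at hA hB
  by_contra hne
  push Not at hne
  have hA' : ‖ι.symm (((inftySymbol g k₀⁻¹).re : ℝ) : ℂ)‖ < C := lt_of_le_of_ne hA (hne _)
  have hB' : ‖ι.symm (((inftySymbol g (k₀⁻¹ * S)).re : ℝ) : ℂ)‖ < C := lt_of_le_of_ne hB (hne _)
  have hlt : ‖ι.symm ((((msymbol M q₀) g).re : ℝ) : ℂ)‖ < C := by
    rw [hq, Complex.sub_re, Complex.ofReal_sub, map_sub, sub_eq_add_neg]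
    refine lt_of_le_of_lt (PadicAlgCl.isNonarchimedean 3 _ _) (max_lt hA' ?_)
    rwa [norm_neg]
  rw [← hC] at hq₀
  exact absurd hq₀.symm (ne_of_lt hlt)

end Bounded

/-! ### §3 The normalisation `Ω`: integral on `ℚ`, a unit on one cycle (squarefree level, one non-Eisenstein prime) -/

section Period

variable {M : ℕ} [NeZero M] (g : CuspForm (Gamma0 M) 2)

omit [NeZero M] in
/-- `{∞, kp∞} = {∞, k∞}` for `p ∈ SL₂(ℤ)_∞ = {±Tⁿ}` (`p∞ = ∞`): the first column of `kp` is `±` that of `k`.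
[folklore] -/
theorem inftySymbol_mul_of_apply_one_zero_eq_zero (k p : SL(2, ℤ)) (hp : p 1 0 = 0) :
    inftySymbol g (k * p) = inftySymbol g k := by
  have hdet := Matrix.SpecialLinearGroup.det_coe p
  rw [Matrix.det_fin_two, hp, mul_zero, sub_zero] at hdet
  have hε : p 0 0 = 1 ∨ p 0 0 = -1 := Int.eq_one_or_neg_one_of_mul_eq_one hdet
  refine inftySymbol_eq_of_apply_eq g (p 0 0) hε ?_ ?_
  · simp [Matrix.mul_apply, Fin.sum_univ_two, hp, mul_comm]
  · simp [Matrix.mul_apply, Fin.sum_univ_two, hp, mul_comm]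

/-- `plusSymbol g x = Re{∞, k∞}_g` for `k` with first column `(num x, den x)` (real coefficients). [folklore] -/
theorem plusSymbol_eq_re_inftySymbol (hreal : ∀ n, (cuspCoeff g n).im = 0) {x : ℚ} {k : SL(2, ℤ)}
    (h0 : k 0 0 = x.num) (h1 : k 1 0 = x.den) :
    plusSymbol g x = (((inftySymbol g k).re : ℝ) : ℂ) := by
  rw [inftySymbol_eq_modularSymbol g h0 h1, plusSymbol_eq_re_holds g hreal x]

/-- **Same cusp class ⟹ the plus symbols differ by a CYCLE value** (squarefree level): if
`gcd(den x, M) = gcd(den y, M)` then `plusSymbol g y = plusSymbol g x − Re{∞, γ∞}_g` for some `γ ∈ Γ₀(M)`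
(cusp classes at squarefree level, `cuspOrbitOf_eq_of_cuspDivisor_eq`; Manin relation `inftySymbol_mul_of_mem`).
[cite: DiamondShurman2005, §3.8] [cite: CremonaAlgorithms1997, §2.2] -/
theorem exists_plusSymbol_eq_sub_re_cuspSymbol (hM : Squarefree M) (hreal : ∀ n, (cuspCoeff g n).im = 0)
    {x y : ℚ} (hxy : Nat.gcd x.den M = Nat.gcd y.den M) :
    ∃ γ : Gamma0 M, plusSymbol g y = plusSymbol g x - (((cuspSymbol g γ).re : ℝ) : ℂ) := by
  obtain ⟨kx, hx0, hx1⟩ := exists_sl_apply_eq_num_den x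
  obtain ⟨ky, hy0, hy1⟩ := exists_sl_apply_eq_num_den y
  have hdiv : cuspDivisor M kx = cuspDivisor M ky := by
    rw [cuspDivisor, cuspDivisor, hx1, hy1, Int.gcd_natCast_natCast, Int.gcd_natCast_natCast, hxy]
  obtain ⟨γ, hγ, hp⟩ := (cuspOrbitOf_eq_iff M kx ky).mp (cuspOrbitOf_eq_of_cuspDivisor_eq hM hdiv)
  refine ⟨⟨γ, hγ⟩, ?_⟩
  have hmanin := inftySymbol_mul_of_mem g hγ ky
  have hfix : inftySymbol g (γ * ky) = inftySymbol g kx := by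
    rw [show γ * ky = kx * (kx⁻¹ * γ * ky) by group]
    exact inftySymbol_mul_of_apply_one_zero_eq_zero g kx _ hp
  rw [plusSymbol_eq_re_inftySymbol g hreal hy0 hy1, plusSymbol_eq_re_inftySymbol g hreal hx0 hx1, ← hfix, hmanin,
    Complex.add_re, Complex.ofReal_add, add_sub_cancel_left]

variable {g}

/-- ★ **THE CANONICAL-PERIOD NORMALISATION at squarefree level from ONE non-Eisenstein prime.** Let `g` be a
newform on `Γ₀(M)`, `M` SQUAREFREE, `ι : ℚ̄₃ ≃ ℂ`, and `r ∤ M` a prime with `a_r(g) − (r + 1)` a `3`-adic unit.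
Then there is `Ω ∈ ℂ` such that `plusSymbol g x / Ω` is `3`-integral for EVERY `x ∈ ℚ` and `plusSymbol g (γ₀∞)/Ω`
is a UNIT for some `γ₀ ∈ Γ₀(M)` with `γ₀∞ ≠ ∞` — exactly the `(Ω, γ₀)` input of THEOREM D
(`…VatsalIhara.exists_valuation_stabilisedSymbol_eq_one_of_ribet1984_iharaLemma`). `Ω` is a path value
`Re{∞, x⋆}_g` of maximal norm (§2); were all cycle values in `𝔪Ω`, the reduced symbol would be constant on cusp
classes `= gcd(den, M)` (`exists_plusSymbol_eq_sub_re_cuspSymbol`), the Hecke relation at `r`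
(`cuspCoeff_mul_plusSymbol`, denominators §1) would read `(a_r − r − 1)·φ̄ = 0`, so `φ̄ ≡ 0`, against `φ̄(x⋆) = 1`.
[cite: Vatsal1999, §1 (1.3) display (5), (1.5)–(1.6), Remark (1.12)] [cite: CremonaAlgorithms1997, §2.3 and §2.8]
[cite: DiamondShurman2005, §3.8] -/
theorem exists_period_integral_unit_cycle (ι : PadicAlgCl 3 ≃+* ℂ) (hM : Squarefree M) (hg : IsNewform0 g)
    {r : ℕ} (hr : r.Prime) (hrM : ¬ r ∣ M) (hE : Valued.v (ι.symm (cuspCoeff g r - (r + 1))) = 1) :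
    ∃ Ω : ℂ, (∀ x : ℚ, Valued.v (ι.symm (plusSymbol g x / Ω)) ≤ 1) ∧
      ∃ γ₀ : Gamma0 M, (γ₀ : SL(2, ℤ)) 1 0 ≠ 0 ∧
        Valued.v (ι.symm (plusSymbol g
          ((((γ₀ : SL(2, ℤ)) 0 0 : ℤ) : ℚ) / (((γ₀ : SL(2, ℤ)) 1 0 : ℤ) : ℚ)) / Ω)) = 1 := by
  classical
  haveI := charP_residueField
  haveI : NeZero r := ⟨hr.ne_zero⟩
  set res := IsLocalRing.residue (Valued.integer (PadicAlgCl 3)) with hres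
  have hreal : ∀ n, (cuspCoeff g n).im = 0 := hg.cuspCoeff_im_eq_zero
  -- §2: the bound `C`, attained at a path `k⋆`; `C > 0`
  set C := Finset.univ.sup' ⟨((1 : SL(2, ℤ)) : Gamma0Coset M), Finset.mem_univ _⟩
    (fun q : Gamma0Coset M ↦ ‖ι.symm ((((msymbol M q) g).re : ℝ) : ℂ)‖) with hC
  have hle : ∀ k : SL(2, ℤ), ‖ι.symm (((inftySymbol g k).re : ℝ) : ℂ)‖ ≤ C := norm_re_inftySymbol_le_sup g ι
  obtain ⟨kS, hkS⟩ := exists_norm_re_inftySymbol_eq_sup g ι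
  rw [← hC] at hkS
  have hC0 : 0 < C := by
    obtain ⟨γ, hγ⟩ := exists_re_cuspSymbol_ne_zero g hg.ne_zero
    have h1 : ι.symm (((cuspSymbol g γ).re : ℝ) : ℂ) ≠ 0 := by
      rw [map_ne_zero_iff _ ι.symm.injective]; exact_mod_cast hγ
    exact (norm_pos_iff.mpr h1).trans_le (hle (γ : SL(2, ℤ)))
  set Ω : ℂ := (((inftySymbol g kS).re : ℝ) : ℂ) with hΩdef
  have hΩC : ‖ι.symm Ω‖ = C := hkS
  have hΩ0 : ι.symm Ω ≠ 0 := by rw [← norm_pos_iff, hΩC]; exact hC0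
  have hkS10 : kS 1 0 ≠ 0 := by
    intro h0
    have : inftySymbol g kS = 0 := by rw [inftySymbol, if_pos h0]
    apply hΩ0
    rw [hΩdef, this, Complex.zero_re, Complex.ofReal_zero, map_zero]
  -- (i) integrality on `ℚ`
  have hnorm : ∀ z : ℂ, ‖ι.symm (z / Ω)‖ = ‖ι.symm z‖ / C := by
    intro z; rw [map_div₀, norm_div, hΩC]
  have hint : ∀ x : ℚ, Valued.v (ι.symm (plusSymbol g x / Ω)) ≤ 1 := by
    intro x
    obtain ⟨k, h0, h1⟩ := exists_sl_apply_eq_num_den x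
    rw [valuation_le_one_iff, hnorm, plusSymbol_eq_re_inftySymbol g hreal h0 h1, div_le_one hC0]
    exact hle k
  refine ⟨Ω, hint, ?_⟩
  -- (ii) a unit on some cycle
  by_contra H
  push Not at H
  -- every cycle value lies in `𝔪Ω`
  have hcyc : ∀ γ : Gamma0 M, ‖ι.symm ((((cuspSymbol g γ).re : ℝ) : ℂ) / Ω)‖ < 1 := by
    intro γ
    by_cases h0 : (γ : SL(2, ℤ)) 1 0 = 0
    · rw [cuspSymbol, if_pos h0, Complex.zero_re, Complex.ofReal_zero, zero_div, map_zero, norm_zero]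
      exact zero_lt_one
    · have hγ := H γ h0
      rw [cuspSymbol, if_neg h0, ← plusSymbol_eq_re_holds g hreal]
      have h1 := hint ((((γ : SL(2, ℤ)) 0 0 : ℤ) : ℚ) / (((γ : SL(2, ℤ)) 1 0 : ℤ) : ℚ))
      rw [valuation_le_one_iff] at h1
      rw [Ne, valuation_eq_one_iff] at hγ
      exact lt_of_le_of_ne h1 hγ
  -- membership proofs and the reduced symbol `ψ`
  have mX : ∀ x : ℚ, ι.symm (plusSymbol g x / Ω) ∈ Valued.integer (PadicAlgCl 3) := fun x ↦
    mem_integer_iff_norm_le_one.mpr (valuation_le_one_iff.mp (hint x))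
  let ψ : ℚ → IsLocalRing.ResidueField (Valued.integer (PadicAlgCl 3)) := fun x ↦ res ⟨ι.symm (plusSymbol g x / Ω), mX x⟩
  -- (E) `ψ` is constant on cusp classes `gcd(den, M)`
  have hE' : ∀ x y : ℚ, Nat.gcd x.den M = Nat.gcd y.den M → ψ y = ψ x := by
    intro x y hxy
    obtain ⟨γ, hγ⟩ := exists_plusSymbol_eq_sub_re_cuspSymbol g hM hreal hxy
    have mγ : ι.symm ((((cuspSymbol g γ).re : ℝ) : ℂ) / Ω) ∈ Valued.integer (PadicAlgCl 3) :=
      mem_integer_iff_norm_le_one.mpr (hcyc γ).le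
    have hO : (⟨ι.symm (plusSymbol g y / Ω), mX y⟩ : Valued.integer (PadicAlgCl 3)) =
        ⟨ι.symm (plusSymbol g x / Ω), mX x⟩ - ⟨ι.symm ((((cuspSymbol g γ).re : ℝ) : ℂ) / Ω), mγ⟩ := by
      apply Subtype.ext
      push_cast
      rw [← map_sub, hγ, sub_div]
    show res _ = res _
    rw [hO, map_sub, residue_mk_eq_zero_of_norm_lt_one mγ (hcyc γ), sub_zero]
  -- (F) the Hecke relation at `r` kills `ψ`
  have ma : ι.symm (cuspCoeff g r) ∈ Valued.integer (PadicAlgCl 3) :=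
    mem_integer_iff_norm_le_one.mpr (valuation_le_one_iff.mp (valuation_cuspCoeff_le_one_of_isNewform0 hg ι r))
  have hunit : res ⟨ι.symm (cuspCoeff g r), ma⟩ -
      ((r : IsLocalRing.ResidueField (Valued.integer (PadicAlgCl 3))) + 1) ≠ 0 := by
    have mE : ι.symm (cuspCoeff g r - (r + 1)) ∈ Valued.integer (PadicAlgCl 3) :=
      mem_integer_iff_norm_le_one.mpr (valuation_eq_one_iff.mp hE).le
    have heq : (⟨ι.symm (cuspCoeff g r - (r + 1)), mE⟩ : Valued.integer (PadicAlgCl 3)) =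
        ⟨ι.symm (cuspCoeff g r), ma⟩ - ((r : Valued.integer (PadicAlgCl 3)) + 1) := by
      apply Subtype.ext
      push_cast
      rw [map_sub, map_add, map_natCast, map_one]
    have h : res ⟨ι.symm (cuspCoeff g r - (r + 1)), mE⟩ =
        res ⟨ι.symm (cuspCoeff g r), ma⟩ - ((r : IsLocalRing.ResidueField (Valued.integer (PadicAlgCl 3))) + 1) := by
      rw [heq, map_sub res, map_add res, map_natCast res, map_one res]
    rw [← h, Ne, IsLocalRing.residue_eq_zero_iff, IsLocalRing.mem_maximalIdeal, mem_nonunits_iff, not_not,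
      Valuation.Integers.isUnit_iff_valuation_eq_one (Valuation.integer.integers _)]
    exact hE
  have hF : ∀ x : ℚ, ψ x = 0 := by
    intro x
    have hH := cuspCoeff_mul_plusSymbol r hg hr hrM x
    -- in `𝒪`
    have hO : (⟨ι.symm (cuspCoeff g r), ma⟩ : Valued.integer (PadicAlgCl 3)) * ⟨ι.symm (plusSymbol g x / Ω), mX x⟩ =
        (∑ j : Fin r, ⟨ι.symm (plusSymbol g ((x + j) / r) / Ω), mX ((x + j) / r)⟩) +
          ⟨ι.symm (plusSymbol g (r * x) / Ω), mX (r * x)⟩ := by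
      apply Subtype.ext
      push_cast
      rw [← map_mul, ← map_sum, ← map_add]
      congr 1
      rw [mul_div_assoc', hH, add_div, Finset.sum_div]
    have h := congrArg res hO
    rw [map_mul, map_add, map_sum] at h
    -- every term on the right is `ψ x`
    have hj : ∀ j : Fin r, res ⟨ι.symm (plusSymbol g ((x + j) / r) / Ω), mX ((x + j) / r)⟩ = ψ x := by
      intro j
      refine hE' x _ ?_
      rw [gcd_den_div_prime hr hrM, show (x + (j : ℚ)) = x + ((j : ℕ) : ℤ) by push_cast; rfl,
        Rat.add_intCast_den]
    have hrx : res ⟨ι.symm (plusSymbol g (r * x) / Ω), mX (r * x)⟩ = ψ x :=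
      hE' x _ (gcd_den_prime_mul hr hrM x).symm
    simp only [hj, hrx, Finset.sum_const, Finset.card_univ, Fintype.card_fin, nsmul_eq_mul] at h
    -- `(res a_r − (r + 1)) ψ x = 0`
    have hψ : (res ⟨ι.symm (cuspCoeff g r), ma⟩ -
        ((r : IsLocalRing.ResidueField (Valued.integer (PadicAlgCl 3))) + 1)) * ψ x = 0 := by
      rw [sub_mul, add_mul, one_mul, h, sub_self]
    exact (mul_eq_zero.mp hψ).resolve_left hunit
  -- (G) but `ψ(x⋆) = 1`
  set xS : ℚ := ((kS 0 0 : ℤ) : ℚ) / ((kS 1 0 : ℤ) : ℚ) with hxS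
  have hΩx : plusSymbol g xS = Ω := by
    rw [hΩdef, inftySymbol, if_neg hkS10, plusSymbol_eq_re_holds g hreal]
  have h1 : ψ xS = 1 := by
    have hO : (⟨ι.symm (plusSymbol g xS / Ω), mX xS⟩ : Valued.integer (PadicAlgCl 3)) = 1 := by
      apply Subtype.ext
      push_cast
      rw [hΩx, div_self (fun h ↦ hΩ0 (by rw [h, map_zero])), map_one]
    show res _ = 1
    rw [hO, map_one]
  exact one_ne_zero (h1 ▸ hF xS)

end Period

end Summit.BirchSwinnertonDyer.BirchSwinnertonDyer.Theorems.KimAtThreeDeepLowerOffStratumLevelLoweringCanonicalPeriod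

end
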